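import Summits.BirchSwinnertonDyer.BirchSwinnertonDyer.Theorems.GenusKolyvaginAtTwoGenusPrimitiveSupplyAtTwoPosDiscShallowKFourPosHalvingDescentCorollaries
import Summits.BirchSwinnertonDyer.BirchSwinnertonDyer.Theorems.GenusKolyvaginAtTwoSupplyKernelsLossless
import HarnessLib

/-!
# Route `GenusKolyvaginAtTwo`, crux K₄⁺ `K4Pos` (stmt-BirchSwinnertonDyer-31469; sign-free, so also K₄ `K4Neg` 31526) —
# K₄⁺ / K₄ ARE LOSSLESS ON THE CUT: the deep kernels FOLLOW from the leaf `Rank1Residual.NonCMAtTwo` modulo PRINT and Q2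
# (answer to LEAD-BRIEF-g22 §3 «LOSSLESSNESS of K₄ is OPEN», WITHOUT the Kolyvagin–McCallum structure theorem at `2`)

Width seat `bsd-line-gk2-p5` g36 (cell `bsd-f1-sign2`), `--supports stmt-BirchSwinnertonDyer-31469 --as helper`.  THEOREMS ONLY
(no definition, no named fact, no `sorry`).  **BSD is NOT proved by this file; K4Pos / K4Neg are NOT proved; nothing is closed.**  Every
theorem below is CONDITIONAL on the leaf `NonCMAtTwo` (the statement the route wants to prove), on the route's PRINT items
`GrossZagierAllLevels` (24148), `EntireLFunctionRat` (19273), `MultPublishedInputsAtTwo` (19921), `MilneAnyModel` (24149) and on Q2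
`KolyvaginRelationAtTwo` (24880; a tree theorem modulo the print fact 23091): it is a LOSSLESSNESS certificate, the converse direction of the
LEAD's route ledger, for the last two kernels of the line.

THE ARGUMENT (gk2-p5 g34's `GenusSupplyNarrow.Lossless` §1/§3 + this seat's halving descent B2Q♭):
* leaf + PRINT ⟹ `#Ш(E/K)[2^∞] = 4^(M₀)` (`Lossless.natCard_primaryComponent_sha_baseChange_two_eq_pow_of_nonCMAtTwo`);
* if NO transposition-deep prime-level witness existed, B2Q♭ (`PlusDescent.kFourPos_shape_of_mem_sha_rat_of_two_pow_pred_smul_ne_zero`,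
  contrapositive) would give `2^(M₀−1) · Ш(E/ℚ)[2^∞] = 0`, and the sign-free pair sandwich with DECOUPLED exponents
  (`Lossless.natCard_primaryComponent_sha_baseChange_two_dvd_pow_of_shaExponent`, unconditional) would give `#Ш(E/K)[2^∞] ∣ 4^(M₀−1)` —
  impossible for `M₀ ≥ 1`.
So on the supply frame with an odd multiplicative prime (the cut on which `closes` consumes the supply), **the CONCLUSION of K4Pos / K4Neg
(`∃ n` square-free, a datum `d`, every `ℓ ∣ n` a Zhang–Kolyvagin prime at `2` of index `≥ 2` with an arithmetic Frobenius moving a point of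
`E[2]`, `P(n) ∉ 2E(K[n])`) FOLLOWS from the leaf modulo PRINT + Q2** — with `n` a single PRIME.  Hence, with g34's K₁/K₁⁺ losslessness: on
the cut, EVERY kernel of the line (K₁, K₁⁺, K₄, K₄⁺) is implied by the leaf modulo PRINT + Q2; the line over-claims nothing there.  (The K4Neg
text asks `FrobEqFrobInfty`-type primes; the witness produced here carries a Frobenius that moves a point of `E[2]` and acts on `K` as a complex
conjugation — on `Δ < 0` the same kind of prime up to the tree's bookkeeping, not re-typed here.)

HONEST FRAMING: conditional on the leaf; a necessity statement, not progress on BSD.  BSD is NOT proved by any of this.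

References: [McCallumLMS1991] §5 Lemma 5.1, Lemma 5.3, Thm. 5.4; [Kolyvagin1989Izv] Thm. B₂; [GrossZagier1986] V.§2 (2.2); [Kramer1981] Thm. 1;
[Milne1972ArithmeticAV] §1 Thm. 1.
-/

set_option autoImplicit false
-- the Theorems namespace of this sub repeats the summit name by design (D-0017 nested layout)
set_option linter.dupNamespace false

noncomputable section

open scoped Classical

namespace Summit.BirchSwinnertonDyer.BirchSwinnertonDyer.Theorems.GenusExact.PlusDescent

open WeierstrassCurve NumberField IsDedekindDomain Field Literature.NumberTheory.EllipticCurves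
  Literature.NumberTheory.GaloisRepresentations Literature.NumberTheory.EllipticCurves.ModularForms
  Literature.NumberTheory.EllipticCurves.RingClassField
open Summit.BirchSwinnertonDyer.BirchSwinnertonDyer.Rank1Residual (NonCMAtTwo)
open Summit.BirchSwinnertonDyer.BirchSwinnertonDyer.Theses.GenusKolyvaginAtTwo
  (KolyvaginRelationAtTwo GrossZagierAllLevels EntireLFunctionRat MultPublishedInputsAtTwo MilneAnyModel)
open Summit.BirchSwinnertonDyer.BirchSwinnertonDyer.Theorems.GenusSupplyNarrow

/-- **K₄⁺ / K₄ ARE LOSSLESS ON THE CUT.**  At a supply frame of the habitat — `E/ℚ` globally minimal, non-CM, analytic rank `0`, `ρ_{E,2^n}`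
onto, odd Tamagawa product, an odd multiplicative prime `v`; `K` imaginary quadratic, `d_K` odd `≠ −3`, Heegner, the two Theorem-B₂ non-squares;
an odd-Manin datum `Dt`; `d₁` with `P(1)` of infinite order and `2^(M₀) ∥ P(1)`, `M₀ ≥ 1`; a globally minimal twin `Wd ≅ E^(d_K)` of analytic
rank `1` with `#Sel₂(Wd) = 2` and the budget (`Δ < 0 ∧ ord₂ C(Wd) ≤ 1`) ∨ (`Δ > 0 ∧ ord₂ C(Wd) = 0`) — **the leaf `NonCMAtTwo`, the four PRINT
items and Q2 imply the conclusion of K4Pos / K4Neg**: a square-free `n` (one prime), a datum `d` of conductor `n`, every `ℓ ∣ n` a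
Zhang–Kolyvagin prime at `2` of index `≥ 2` with an arithmetic Frobenius moving a point of `E[2]`, and `P(n) ∉ 2E(K[n])`.
CONDITIONAL on the leaf; BSD is NOT proved by this; K4Pos is NOT proved by this. [cite: McCallumLMS1991, §5 Thm. 5.4]
[cite: GrossZagier1986, V.§2 (2.2)] [cite: Kramer1981, Thm. 1] -/
theorem kFourPos_shape_of_nonCMAtTwo_onCut
    (hleaf : NonCMAtTwo) (hGZ : GrossZagierAllLevels) (hL : EntireLFunctionRat) (hGZK : MultPublishedInputsAtTwo) (hMi : MilneAnyModel)
    (hQ2 : KolyvaginRelationAtTwo)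
    (W : WeierstrassCurve ℚ) [W.IsElliptic] [W.IsGloballyMinimal] [NeZero (W.conductorNorm ℤ)] (hcm : ¬ W.HasCM) (hr0 : W.analyticRank = 0)
    (hρ : ∀ n : ℕ, 0 < n → W.HasSurjectiveModNGaloisRep ((2 : ℤ) ^ n)) (hT : Odd W.tamagawaProduct)
    (v : HeightOneSpectrum (𝓞 ℚ)) (h2v : ((2 : ℕ) : 𝓞 ℚ) ∉ v.asIdeal) (hNv : ((W.conductorNorm ℤ : ℕ) : 𝓞 ℚ) ∈ v.asIdeal)
    (hmult : W.HasMultiplicativeReductionAt v)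
    (K : Type) [Field K] [NumberField K] (hIQ : IsImaginaryQuadratic K) (hodd : Odd (NumberField.discr K))
    (h3 : NumberField.discr K ≠ -3) (hHe : SatisfiesHeegnerHypothesis (W.conductorNorm ℤ) K)
    (hsq1 : ¬ IsSquare ((NumberField.discr K : ℚ) * -|W.Δ|)) (hsq2 : ¬ IsSquare ((NumberField.discr K : ℚ) * (-(2 * |W.Δ|))))
    (Dt : ModularParametrizationData W (W.conductorNorm ℤ)) (hc : Odd Dt.c) (β : ℤ) (ι : K →+* ℂ) (d₁ : KolyvaginHeegnerData Dt β ι 1)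
    (hy : ¬ IsOfFinAddOrder d₁.derivedPoint) (M₀ : ℕ)
    (hdiv : ∃ Q : (W.baseChange (ringClassField K ι 1)).toAffine.Point, ((2 ^ M₀ : ℕ) : ℤ) • Q = d₁.derivedPoint)
    (hndiv : ¬ ∃ Q : (W.baseChange (ringClassField K ι 1)).toAffine.Point, ((2 ^ (M₀ + 1) : ℕ) : ℤ) • Q = d₁.derivedPoint)
    (hM₀ : 1 ≤ M₀)
    (Wd : WeierstrassCurve ℚ) [Wd.IsElliptic] [Wd.IsGloballyMinimal]
    (hWd : ∃ C : VariableChange ℚ, C • W.quadraticTwist (NumberField.discr K : ℚ) = Wd) (hrd : Wd.analyticRank = 1)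
    (hSel : Nat.card (Wd.selmerGroup 2) = 2)
    (hbudget : (W.Δ < 0 ∧ padicValNat 2 Wd.tamagawaProduct ≤ 1) ∨ (0 < W.Δ ∧ padicValNat 2 Wd.tamagawaProduct = 0)) :
    ∃ (n : ℕ) (d : KolyvaginHeegnerData Dt β ι n), Squarefree n ∧
      (∀ ℓ ∈ n.primeFactors, Zhang2014.IsKolyvaginPrime (W.conductorNorm ℤ) W K 2 ℓ ∧ 2 ≤ Zhang2014.kolyvaginIndex W 2 ℓ ∧
        ∃ (v : HeightOneSpectrum (𝓞 ℚ)) (𝔓 : Ideal (absIntegers (𝓞 ℚ) ℚ)) (h : absoluteGaloisGroup ℚ),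
          ((ℓ : ℕ) : 𝓞 ℚ) ∈ v.asIdeal ∧ 𝔓 ∈ v.primesAbove ∧ IsArithFrobAt (𝓞 ℚ) h 𝔓 ∧ ∃ u : W.geomTorsion ((2 : ℕ) : ℤ), h • u ≠ u) ∧
      ¬ ∃ Q : (W.baseChange (ringClassField K ι n)).toAffine.Point, (2 : ℤ) • Q = d.derivedPoint := by
  haveI : Fact (Nat.Prime 2) := ⟨Nat.prime_two⟩
  have hρ2 : W.HasSurjectiveModNGaloisRep 2 := by simpa using hρ 1 one_pos
  -- `w(E) = +1` and `rank E(ℚ) = 0` from `r_an(E) = 0` (functional equation of the newform of `Dt`; Gross–Zagier–Kolyvagin)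
  have hw : W.rootNumber = 1 :=
    (Literature.Barriers.BirchSwinnertonDyer.even_analyticRank_iff_of_isNewformOf_conductorLevel Dt.isNewformOf).mp
      (by rw [hr0]; exact Even.zero)
  have hrk0 : W.mordellWeilRank = 0 := by rw [(hGZK W (by rw [hr0]; exact zero_le_one)).1, hr0]
  -- leaf + PRINT: `#Ш(E/K)[2^∞] = 4^(M₀)`
  have hpow := Lossless.natCard_primaryComponent_sha_baseChange_two_eq_pow_of_nonCMAtTwo hleaf hGZ hL hGZK hMi W hcm hρ2 hT hr0 K hIQ
    hodd h3 hHe Dt hc β ι d₁ M₀ hdiv hndiv Wd hWd hrd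
  by_contra hno
  -- no witness ⟹ `2^(M₀−1) · Ш(E/ℚ)[2^∞] = 0` (B2Q♭, contrapositive)
  have hB2Q : ∀ (k : ℕ) (a : W.galH1), a ∈ W.sha → ((2 ^ k : ℕ) : ℤ) • a = 0 → ((2 ^ (M₀ - 1) : ℕ) : ℤ) • a = 0 := by
    intro k a ha hka
    by_contra hne
    exact hno (kFourPos_shape_of_mem_sha_rat_of_two_pow_pred_smul_ne_zero hQ2 W hcm hT v h2v hNv hmult K hIQ hodd h3 hHe hsq1 hsq2 hρ Dt β
      ι d₁ M₀ hndiv hw k a ha hka hne)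
  -- the sign-free sandwich with decoupled exponents: `#Ш(E/K)[2^∞] ∣ 4^(M₀−1)`
  have hdvd := Lossless.natCard_primaryComponent_sha_baseChange_two_dvd_pow_of_shaExponent W K hT hIQ hodd hHe hρ2 Dt β ι d₁ hy M₀ hndiv hw
    hrk0 Wd hWd hSel hbudget hB2Q
  rw [hpow] at hdvd
  have hle : 2 * M₀ ≤ 2 * (M₀ - 1) := (Nat.pow_dvd_pow_iff_le_right (by norm_num : 1 < 2)).mp hdvd
  omega

/-- **K4Pos's own frame** (`Δ > 0`, the real-narrow `#Sel₂(E) = 4` cell, `K = ℚ(√−ℓ₀)` prime frame, shallow twin `ord₂ C(Wd) = 0`) plus one odd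
multiplicative prime: leaf + PRINT + Q2 ⟹ the conclusion of K4Pos VERBATIM.  The cell, the prime-frame clauses and the odd-Manin lattice clause
are idle (displayed for by-name use by the planner-of-record).  CONDITIONAL on the leaf; BSD is NOT proved by this; K4Pos is NOT proved by this.
[cite: McCallumLMS1991, §5 Thm. 5.4] [cite: GrossZagier1986, V.§2 (2.2)] -/
theorem kFourPos_conclusion_of_nonCMAtTwo_of_hasMultiplicativeReductionAt
    (hleaf : NonCMAtTwo) (hGZ : GrossZagierAllLevels) (hL : EntireLFunctionRat) (hGZK : MultPublishedInputsAtTwo) (hMi : MilneAnyModel)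
    (hQ2 : KolyvaginRelationAtTwo)
    (W : WeierstrassCurve ℚ) [W.IsElliptic] [W.IsGloballyMinimal] [NeZero (W.conductorNorm ℤ)] (hcm : ¬ W.HasCM) (hr0 : W.analyticRank = 0)
    (hρ : ∀ n : ℕ, 0 < n → W.HasSurjectiveModNGaloisRep ((2 : ℤ) ^ n)) (hT : Odd W.tamagawaProduct) (hΔ : 0 < W.Δ)
    (_hcell : Nat.card (W.selmerGroup 2) = 4 ∧ ∃ c ∈ (W.kummerSelmerStructure ((2 : ℕ) : ℤ)).selmerGroup,
      Literature.NumberTheory.GaloisRepresentations.galoisCohomology.localization (W.torsionGaloisModule ((2 : ℕ) : ℤ))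
        (Sum.inl Rat.infinitePlace) 1 c ≠ 0)
    (v : HeightOneSpectrum (𝓞 ℚ)) (h2v : ((2 : ℕ) : 𝓞 ℚ) ∉ v.asIdeal) (hNv : ((W.conductorNorm ℤ : ℕ) : 𝓞 ℚ) ∈ v.asIdeal)
    (hmult : W.HasMultiplicativeReductionAt v)
    (K : Type) [Field K] [NumberField K] (hIQ : IsImaginaryQuadratic K) (hodd : Odd (NumberField.discr K))
    (h3 : NumberField.discr K ≠ -3) (hHe : SatisfiesHeegnerHypothesis (W.conductorNorm ℤ) K)
    (hsq1 : ¬ IsSquare ((NumberField.discr K : ℚ) * -|W.Δ|)) (hsq2 : ¬ IsSquare ((NumberField.discr K : ℚ) * (-(2 * |W.Δ|))))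
    (ℓ₀ : ℕ) (_hℓ₀ : ℓ₀.Prime) (_hdK : NumberField.discr K = -(ℓ₀ : ℤ))
    (_h2K : ((Ideal.span {(2 : ℤ)}).primesOver (NumberField.RingOfIntegers K)).ncard = 2)
    (Dt : ModularParametrizationData W (W.conductorNorm ℤ))
    (_hopt : ∀ z ∈ Dt.L.lattice, ∃ w ∈ periodLattice Dt.f, z = (Dt.c : ℂ) * w) (hc : Odd Dt.c)
    (β : ℤ) (ι : K →+* ℂ) (d₁ : KolyvaginHeegnerData Dt β ι 1) (hy : ¬ IsOfFinAddOrder d₁.derivedPoint) (M₀ : ℕ)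
    (hdiv : ∃ Q : (W.baseChange (ringClassField K ι 1)).toAffine.Point, ((2 ^ M₀ : ℕ) : ℤ) • Q = d₁.derivedPoint)
    (hndiv : ¬ ∃ Q : (W.baseChange (ringClassField K ι 1)).toAffine.Point, ((2 ^ (M₀ + 1) : ℕ) : ℤ) • Q = d₁.derivedPoint)
    (hM₀ : 1 ≤ M₀)
    (Wd : WeierstrassCurve ℚ) [Wd.IsElliptic] [Wd.IsGloballyMinimal]
    (hWd : ∃ C : VariableChange ℚ, C • W.quadraticTwist (NumberField.discr K : ℚ) = Wd) (hrd : Wd.analyticRank = 1)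
    (hSel : Nat.card (Wd.selmerGroup 2) = 2) (hTam : padicValNat 2 Wd.tamagawaProduct = 0) :
    ∃ (n : ℕ) (d : KolyvaginHeegnerData Dt β ι n), Squarefree n ∧
      (∀ ℓ ∈ n.primeFactors, Zhang2014.IsKolyvaginPrime (W.conductorNorm ℤ) W K 2 ℓ ∧ 2 ≤ Zhang2014.kolyvaginIndex W 2 ℓ ∧
        ∃ (v : HeightOneSpectrum (𝓞 ℚ)) (𝔓 : Ideal (absIntegers (𝓞 ℚ) ℚ)) (h : absoluteGaloisGroup ℚ),
          ((ℓ : ℕ) : 𝓞 ℚ) ∈ v.asIdeal ∧ 𝔓 ∈ v.primesAbove ∧ IsArithFrobAt (𝓞 ℚ) h 𝔓 ∧ ∃ u : W.geomTorsion ((2 : ℕ) : ℤ), h • u ≠ u) ∧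
      ¬ ∃ Q : (W.baseChange (ringClassField K ι n)).toAffine.Point, (2 : ℤ) • Q = d.derivedPoint :=
  kFourPos_shape_of_nonCMAtTwo_onCut hleaf hGZ hL hGZK hMi hQ2 W hcm hr0 hρ hT v h2v hNv hmult K hIQ hodd h3 hHe hsq1 hsq2 Dt hc β ι d₁ hy M₀
    hdiv hndiv hM₀ Wd hWd hrd hSel (Or.inr ⟨hΔ, hTam⟩)

end Summit.BirchSwinnertonDyer.BirchSwinnertonDyer.Theorems.GenusExact.PlusDescent

end
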